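import Literature.AlgebraicGeometry.AbelianSchemes.AbelianSchemeQuotientDualPairLevelTwist
import Literature.AlgebraicGeometry.AbelianSchemes.AbelianSchemeQuotientDualPairUnique
import Literature.AlgebraicGeometry.AbelianSchemes.RigidifiedTrivialOfOpenCover
import Literature.AlgebraicGeometry.AbelianSchemes.RigidifiedGluingOfCechPic
import Literature.AlgebraicGeometry.AbelianSchemes.LevelStructureTwist
import HarnessLib

/-!
# The universal property of the dual pair of `A/K`: EXISTENCE, fpqc-locally (HECKE-LINK H2, D6 brick (u1)+(u2), part 4 — the head)

Layer `Literature/AlgebraicGeometry/AbelianSchemes`, namespace `Literature.AlgebraicGeometry.AbelianSchemes.AbelianSchemeOver`.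
THEOREMS ONLY; no definition, no named fact, no instance, no notation, no `sorry`.

[MumfordAV1970] §15 Thm. 1 («the dual of `A/K` is `Â/K^⊥`»), [MilneAV2008] I §8 (the universal property of a dual pair): for the
assembly ★ `dualPairOfQuotientRigidified … Φ h4` ((ii) part 3: `hat := Â/K′`, `P := 𝒫_B^{rig}`, three clauses proved) the EXISTENCE
half of `h4` holds fpqc-LOCALLY on the test scheme:

* **`exists_fpqcCover_pullback_poincareQuotRigid_iso`** — for every `f : T → S` and every rigidified fibrewise-`Pic⁰` line bundle `ℒ`
  on `B_T` there are an fpqc cover `c : T₁ → T` (the `[n]`-division cover `T ×_{g̃, Â, [n]} Â` of part 1 — finite, flat, surjective)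
  and `g₁ : T₁ → Â/K′` over `c ≫ f` with `(1_B × g₁)^* 𝒫_B^{rig} ≅ (1_B × c)^* ℒ`; this is EXACTLY the input `(c, g₁, hg₁, e₁)` of ★
  `ClassifyingMapFpqcDescent.exists_desc_of_solution_of_unique` (B-p16 (g13), (u6a)), after which the isomorphism descends by (u6b)
  (`RigidifiedTrivialFpqcDescent`, B-p13 (g17)) and ★ `existsUnique_poincareQuotRigid_of_exists` closes `h4`.

Road: `g̃ := D.classify (ψ_T^* ℒ)` (★ `DualPair.classify`, ★ `RigidifiedLineBundle.comapHom`); part 1 divides `g̃` by `[n]` and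
identifies `ψ_{T₁}^*((1 × a·φ̂(c))^*𝒩₁) ≅ ψ_{T₁}^*(ℒ|)` for every level twist; part 2 reads the `K`-discrepancy units and proves the two
sides agree on the open piece `G_c`; part 3 proves the `G_c` COVER `T₁`; here the local classifying maps `(a·φ̂(c)) ≫ ψ̂` are GLUED
along the Zariski cover `{G_c}` by the uniqueness ★ `eq_of_pullback_baseChangeToProd_poincareQuotRigid_iso` (from (K)) with Mathlib
`Scheme.Cover.glueMorphisms`, and the isomorphism is globalised to `T₁` by ★ `RigidifiedLineBundle.nonempty_iso_of_openCover_of_isLocallyNoetherian`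
(B-p16 (g14), (u6b-Z)).  Hypotheses beyond the (ii) block: `S` reduced and locally Noetherian, `Â` commutative, `n` invertible in the
residue fields of `S`, a level-`n` structure `φ̂` on `Â`, `#K · #K′ = n^{2g}`, the unit hypothesis `hD`, the stabiliser hypothesis (K)
`hStab` (★ `hStab_of_hChar`), and STEIN for `A` over every base (`hSteinA`, ★ `AbelianSchemeSteinOfNoetherian` currency).

Cell `hodgecm-mathlib`, HECKE-LINK socket (B) file (ii), D6 brick (u1)+(u2) «EXISTENCE half of the universal property of the dual
pair of `A/K`» (B-plan1 (g14) 2026-08-29; design review B-p20 (g9); generic engine ★ `RelativeSpec/PullbackIsoDiscrepancy`, B-p07 (g14)).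
HC_CM is proved only modulo the 7 printed citations until rung 0 closes; nothing here is about HC.

## References
* [MumfordAV1970] D. Mumford, *Abelian Varieties* (1970), §7 Thm. 4 (p. 72), §12 Thm. 1 (p. 112), §15 Thm. 1 (p. 143).
* [MilneAV2008] J. S. Milne, *Abelian Varieties* (2008), I §8 (pp. 36–37), I §9 Thm. 9.1 (p. 42).
* [MumfordFogartyKirwan1994] D. Mumford, J. Fogarty, F. Kirwan, *GIT*, 3rd ed., Ch. 1 §3 Def. 1.6 (p. 30), Ch. 7 §2 Def. 7.1 (p. 129).
* [Greither1992CyclicGalois] C. Greither, LNM 1534 (1992), Ch. 0 Prop. 7.2 (p. 29).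
* [GortzWedhorn2020] U. Görtz, T. Wedhorn, *Algebraic Geometry I*, 2nd ed. (2020), Section (4.7), Thm. 14.72.
-/

noncomputable section

-- `(A.baseChange f).X = (Over.pullback f).obj A.X` / `(A.X ⊗ B.X).left = A.prodLeft B` hold by `rfl` only.
set_option backward.isDefEq.respectTransparency false

universe u

open CategoryTheory CategoryTheory.Limits AlgebraicGeometry MonoidalCategory CartesianMonoidalCategory
open scoped MonObj

namespace Literature.AlgebraicGeometry.AbelianSchemes

namespace AbelianSchemeOver

open Literature.AlgebraicGeometry.RelativeSpec Literature.AlgebraicGeometry.AbelianVarieties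
  Literature.AlgebraicGeometry.Motives Literature.AlgebraicGeometry.Modules

/-! ## The head: fpqc-local EXISTENCE of the classifying map for `(Â/K′, 𝒫_B^{rig})` -/

section Head

variable {S : Scheme.{u}} (A : AbelianSchemeOver S)
  {Y : Scheme.{u}} (u : S ⟶ Y) (K : Subgroup A.Sections) [IsCommMonObj A.X] {n : ℕ}
  (hK : ∀ σ : K, (σ : A.Sections) ^ n = 1)
  [Finite K] [Y.IsSeparated] [IsSeparated (A.X.hom ≫ u)] [S.IsSeparated]
  (hcov : ∀ x : A.left, ∃ O : (A.translationActionOver u K).StableAffineOpens, x ∈ O.1)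
  [LocallyOfFiniteType (A.X.hom ≫ u)] [IsLocallyNoetherian Y]
  (hG : ∃ _ : GrpObj (A.quotientOver u K), IsMonHom (A.quotientMk u K hcov))
  (hsm : Smooth (A.quotientOver u K).hom) (hgc : GeometricallyConnected (A.quotientOver u K).hom)
  (D : A.DualPair) [IsAffine Y]
  (hfree : ∀ (Ω : Type u) [Field Ω] [IsAlgClosed Ω] (x : Spec (.of Ω) ⟶ A.left) (σ : K), σ ≠ 1 →
    x ≫ (A.translation (σ : A.Sections)).left ≠ x)

variable
  -- the dual side: a finite subgroup `K′ ≤ Â(S)` with the file-(i) hypotheses for `(Â, K′)`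
  (K' : Subgroup D.hat.Sections) [Finite K'] [IsSeparated (D.hat.X.hom ≫ u)]
  (hcov' : ∀ x : D.hat.left, ∃ O : (D.hat.translationActionOver u K').StableAffineOpens, x ∈ O.1)
  [LocallyOfFiniteType (D.hat.X.hom ≫ u)]
  (hG' : ∃ _ : GrpObj (D.hat.quotientOver u K'), IsMonHom (D.hat.quotientMk u K' hcov'))
  (hsm' : Smooth (D.hat.quotientOver u K').hom) (hgc' : GeometricallyConnected (D.hat.quotientOver u K').hom)
  (hfree' : ∀ (Ω : Type u) [Field Ω] [IsAlgClosed Ω] (x : Spec (.of Ω) ⟶ D.hat.left) (σ : K'), σ ≠ 1 →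
    x ≫ (D.hat.translation (σ : D.hat.Sections)).left ≠ x)
  -- D3b's output: a `K′`-equivariant structure on `𝒩₁` for the D3a action
  (Φ : (prodTranslationActionOver (A.quotientBy u K hcov hG hsm hgc) D.hat u K' hcov').EquivariantStructure
    (A.poincarePullback u K hK hcov hG hsm hgc D hfree))

include hfree' in
/-- **EXISTENCE half of the universal property of `(Â/K′, 𝒫_B^{rig})`, fpqc-locally on the test scheme** ([MumfordAV1970] §15 Thm. 1,
«the dual of `A/K` is `Â/K^⊥`»; HECKE-LINK D6 (u1)+(u2)).  For `S` reduced and locally Noetherian with `n` invertible in its residue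
fields, the unit hypothesis `hD`, a level-`n` structure `φ̂` on `Â`, `#K · #K′ = n^{2g}`, the stabiliser hypothesis (K) `hStab` and STEIN
for `A` over every base (`hSteinA`): for every `f : T → S` and every rigidified fibrewise-`Pic⁰` line bundle `ℒ` on `B_T` (`B := A/K`)
there are an fpqc cover `c : T₁ → T` (the `[n]`-division cover `T ×_{g̃, Â, [n]} Â`, ★ `flat/surjective/isFinite_fst_of_mulN` — finite,
hence affine and quasi-compact) and `g₁ : T₁ → Â/K′` over `c ≫ f` with `(1_B × g₁)^* 𝒫_B^{rig} ≅ (1_B × c)^* ℒ` — exactly the input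
`(c, g₁, hg₁, e₁)` of ★ `exists_desc_of_solution_of_unique`.  Construction: `g̃ := D.classify (ψ_T^*ℒ)`; on `T₁` the twisted lifts
`a·φ̂(c)` give `ψ_{T₁}^*((1 × a·φ̂(c))^*𝒩₁) ≅ ψ_{T₁}^*(ℒ|)` (★ `nonempty_pullback_division_iso`); their `K`-discrepancy units (§3, ★
`PullbackIsoDiscrepancy`) are `1` on open pieces `G_c` which COVER `T₁` (§4, the character correction by counting); on `G_c` the
classifying map is `(a·φ̂(c)) ≫ ψ̂` (§2–§3); these glue along `T₁` by uniqueness (★ `eq_of_pullback_baseChangeToProd_poincareQuotRigid_iso`,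
Mathlib `Scheme.Cover.glueMorphisms`) and the isomorphism globalises by ★ `RigidifiedLineBundle.nonempty_iso_of_openCover_of_isLocallyNoetherian`.
[cite: MumfordAV1970, §15 Thm. 1 (p. 143)] [cite: MilneAV2008, I §8 (pp. 36–37), I §9 Thm. 9.1 (p. 42)] [cite: GortzWedhorn2020, Thm. 14.72] -/
theorem exists_finiteCover_pullback_poincareQuotRigid_iso [IsReduced S] [IsLocallyNoetherian S] [IsCommMonObj D.hat.X] {g : ℕ}
    (φ : LevelStructure g n D.hat) (hn : ∀ s : S, (n : S.residueField s) ≠ 0) (hcard : Nat.card K * Nat.card K' = n ^ (2 * g))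
    (hD : Nonempty ((Scheme.Modules.pullback (DualPair.unitHatSlice D)).obj D.P ≅ SheafOfModules.unit _))
    (hStab : ∀ {T : Scheme.{u}} (f : T ⟶ S) (a a' : T ⟶ D.hat.X.left) (ha : a ≫ D.hat.X.hom = f)
      (ha' : a' ≫ D.hat.X.hom = f),
      Nonempty ((Scheme.Modules.pullback ((A.quotientBy u K hcov hG hsm hgc).baseChangeToProd D.hat f a ha)).obj
          (A.poincarePullbackBundle u K hK hcov hG hsm hgc D hfree).L ≅
        (Scheme.Modules.pullback ((A.quotientBy u K hcov hG hsm hgc).baseChangeToProd D.hat f a' ha')).obj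
          (A.poincarePullbackBundle u K hK hcov hG hsm hgc D hfree).L) →
      a ≫ (D.hat.quotientMk u K' hcov').left = a' ≫ (D.hat.quotientMk u K' hcov').left)
    (hSteinA : ∀ {T : Scheme.{u}} (f : T ⟶ S) (W : T.Opens), Function.Bijective ((A.baseChange f).X.hom.app W))
    {T : Scheme.{u}} (f : T ⟶ S) (ℒ : (A.quotientBy u K hcov hG hsm hgc).RigidifiedLineBundle f) (hℒ : ℒ.FibrewisePicZero) :
    ∃ (T₁ : Scheme.{u}) (c : T₁ ⟶ T) (_ : Surjective c) (_ : Flat c) (_ : IsFinite c)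
      (g₁ : T₁ ⟶ (D.hat.quotientBy u K' hcov' hG' hsm' hgc').X.left)
      (hg₁ : g₁ ≫ (D.hat.quotientBy u K' hcov' hG' hsm' hgc').X.hom = c ≫ f),
      Nonempty ((Scheme.Modules.pullback ((A.quotientBy u K hcov hG hsm hgc).baseChangeToProd
          (D.hat.quotientBy u K' hcov' hG' hsm' hgc') (c ≫ f) g₁ hg₁)).obj
            (A.poincareQuotRigid u K hK hcov hG hsm hgc D hfree K' hcov' hG' hsm' hgc' Φ) ≅
        (Scheme.Modules.pullback ((A.quotientBy u K hcov hG hsm hgc).prodMap (c ≫ f) f c rfl)).obj ℒ.L) := by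
  classical
  letI : Fintype K := Fintype.ofFinite K
  let B : AbelianSchemeOver S := A.quotientBy u K hcov hG hsm hgc
  let ψ : A.X ⟶ B.X := A.quotientMk u K hcov
  let Bh : AbelianSchemeOver S := D.hat.quotientBy u K' hcov' hG' hsm' hgc'
  let ψh : D.hat.X ⟶ Bh.X := D.hat.quotientMk u K' hcov'
  let N₁ : B.RigidifiedLineBundle D.hat.X.hom := A.poincarePullbackBundle u K hK hcov hG hsm hgc D hfree
  let PB := A.poincareQuotRigid u K hK hcov hG hsm hgc D hfree K' hcov' hG' hsm' hgc' Φ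
  -- Step 1: classify `ψ_T^* ℒ` through `Â`
  let ℒA : A.RigidifiedLineBundle f :=
    @RigidifiedLineBundle.comapHom S A B T ψ (A.isMonHom_quotientMk u K hcov hG hsm hgc) f ℒ
  have hℒA : ℒA.FibrewisePicZero :=
    @RigidifiedLineBundle.FibrewisePicZero.comapHom S A B T ψ (A.isMonHom_quotientMk u K hcov hG hsm hgc) f ℒ hℒ
  let gt : T ⟶ D.hat.X.left := D.classify f ℒA hℒA
  have hgt : gt ≫ D.hat.X.hom = f := D.classify_comp_hom f ℒA hℒA
  have egt : Nonempty (D.pullbackP f gt hgt ≅ (Scheme.Modules.pullback (baseChangeHom ψ f).left).obj ℒ.L) :=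
    D.nonempty_pullbackP_classify_iso f ℒA hℒA
  -- Step 2: the `[n]`-division cover
  let T₁ : Scheme.{u} := pullback gt (D.hat.mulN n).left
  let c : T₁ ⟶ T := pullback.fst gt (D.hat.mulN n).left
  let a : T₁ ⟶ D.hat.X.left := pullback.snd gt (D.hat.mulN n).left
  have hca : c ≫ gt = a ≫ (D.hat.mulN n).left := pullback.condition
  have ha : a ≫ D.hat.X.hom = c ≫ f := by
    rw [← D.hat.mulN_left_comp_hom n, ← Category.assoc, ← hca, Category.assoc, hgt]
  haveI : Surjective c := D.hat.surjective_fst_of_mulN gt hn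
  haveI : Flat c := D.hat.flat_fst_of_mulN gt hn
  haveI : IsFinite c := D.hat.isFinite_fst_of_mulN gt hn
  -- Step 3: the twisted lifts `a·φ̂(cc)` and the division isomorphisms
  let p : Over.mk (c ≫ f) ⟶ D.hat.X := Over.homMk a ha
  let aTw : (Fin g ⊕ Fin g → ZMod n) → (T₁ ⟶ D.hat.X.left) := fun cc =>
    (p * (toUnit (Over.mk (c ≫ f)) ≫ φ.section_ cc)).left
  have haTw : ∀ cc, aTw cc ≫ D.hat.X.hom = c ≫ f := fun cc => Over.w _
  have hTw : ∀ cc, aTw cc ≫ (D.hat.mulN n).left = c ≫ gt := by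
    intro cc
    have h1 : (p * (toUnit (Over.mk (c ≫ f)) ≫ φ.section_ cc)) ^ n = p ^ n := by
      rw [mul_pow, ← MonObj.comp_pow, show φ.section_ cc ^ n = 1 from D.hat.sectionPow_pow_eq_one φ.pow_σ cc,
        MonObj.comp_one, mul_one]
    have h2 := congrArg Over.Hom.left h1
    rw [D.hat.pow_left_eq_comp_mulN_left, D.hat.pow_left_eq_comp_mulN_left] at h2
    exact h2.trans hca.symm
  let F₀ : (B.baseChange (c ≫ f)).X.left.Modules := (Scheme.Modules.pullback (B.prodMap (c ≫ f) f c rfl)).obj ℒ.L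
  have h₀ : HasRank F₀ 1 := hasRank_pullback _ ℒ.hasRank_one
  let F₁ : (Fin g ⊕ Fin g → ZMod n) → (B.baseChange (c ≫ f)).X.left.Modules := fun cc =>
    (Scheme.Modules.pullback (B.baseChangeToProd D.hat (c ≫ f) (aTw cc) (haTw cc))).obj N₁.L
  have h₁ : ∀ cc, HasRank (F₁ cc) 1 := fun cc => hasRank_pullback _ N₁.hasRank_one
  have heq : (baseChangeHom ψ (c ≫ f)).left = (ψ ▷ Over.mk (c ≫ f)).left :=
    A.baseChangeHom_left_eq_whiskerRight_left' B (Over.mk (c ≫ f)) ψ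
  have he : ∀ cc, Nonempty ((Scheme.Modules.pullback (ψ ▷ Over.mk (c ≫ f)).left).obj (F₁ cc) ≅
      (Scheme.Modules.pullback (ψ ▷ Over.mk (c ≫ f)).left).obj F₀) := fun cc =>
    (A.nonempty_pullback_division_iso u K hK hcov hG hsm hgc D hfree hD f ℒ.L gt hgt egt c (aTw cc) (haTw cc) (hTw cc)).map
      fun e₀ => ((Scheme.Modules.pullbackCongr heq).app _).symm ≪≫ e₀ ≪≫ (Scheme.Modules.pullbackCongr heq).app _
  let e := fun cc => (he cc).some
  -- Step 4: the discrepancy units and the open pieces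
  have hvex := fun cc => A.exists_discrepancy_hom u K hK hcov hG hsm hgc hSteinA (c ≫ f) F₀ (F₁ cc) h₀ (e cc)
  choose v hvn hv using hvex
  let U : ULift.{u} (Fin g ⊕ Fin g → ZMod n) → T₁.Opens := fun cc =>
    T₁.basicOpen (∏ σ : K, ∑ i ∈ Finset.range n, v cc.down σ ^ i)
  have hmem : ∀ t₁ : T₁, ∃ cc, t₁ ∈ U cc := fun t₁ => by
    obtain ⟨cc, hcc⟩ := A.exists_mem_basicOpen_levelTwist u K hK hcov hG hsm hgc D hfree K' hcov' hfree' φ hn hcard hStab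
      (c ≫ f) F₀ h₀ a ha e v hv t₁
    exact ⟨⟨cc⟩, hcc _ rfl⟩
  have hU : TopologicalSpace.IsOpenCover U := top_le_iff.mp fun t _ => TopologicalSpace.Opens.mem_iSup.mpr (hmem t)
  let 𝒰 : Scheme.OpenCover.{u} T₁ := T₁.openCoverOfIsOpenCover U hU
  -- Step 5: the local solutions on the pieces
  have hloc : ∀ cc, Nonempty ((Scheme.Modules.pullback (B.prodMap ((U cc).ι ≫ c ≫ f) (c ≫ f) (U cc).ι rfl)).obj (F₁ cc.down) ≅
      (Scheme.Modules.pullback (B.prodMap ((U cc).ι ≫ c ≫ f) (c ≫ f) (U cc).ι rfl)).obj F₀) := fun cc =>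
    A.nonempty_pullback_prodMap_iso_on_basicOpen u K hcov hG hsm hgc hfree (c ≫ f) F₀ (F₁ cc.down) h₀ (h₁ cc.down) (e cc.down)
      (fun σ => v cc.down σ) (hvn cc.down) (hv cc.down) _ rfl
  let gloc : ∀ cc, ((U cc : T₁.Opens) : Scheme.{u}) ⟶ Bh.X.left := fun cc => ((U cc).ι ≫ aTw cc.down) ≫ ψh.left
  have hgloc : ∀ cc, gloc cc ≫ Bh.X.hom = (U cc).ι ≫ c ≫ f := fun cc => by
    change (((U cc).ι ≫ aTw cc.down) ≫ ψh.left) ≫ Bh.X.hom = _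
    rw [Category.assoc, Over.w, Category.assoc, haTw]
  have hsol : ∀ cc, Nonempty ((Scheme.Modules.pullback (B.baseChangeToProd Bh ((U cc).ι ≫ c ≫ f) (gloc cc) (hgloc cc))).obj PB ≅
      (Scheme.Modules.pullback (B.prodMap ((U cc).ι ≫ c ≫ f) (c ≫ f) (U cc).ι rfl)).obj F₀) := by
    intro cc
    obtain ⟨j⟩ := B.nonempty_pullback_prodMap_pullback_baseChangeToProd_iso D.hat N₁.L ((U cc).ι ≫ c ≫ f) (c ≫ f) (U cc).ι rfl
      (aTw cc.down) (haTw cc.down)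
    exact A.nonempty_pullback_poincareQuotRigid_iso_of_pullback_poincarePullback_iso u K hK hcov hG hsm hgc D hfree K' hcov'
      hG' hsm' hgc' hfree' Φ ((U cc).ι ≫ c ≫ f) ((U cc).ι ≫ aTw cc.down) (by rw [Category.assoc, haTw]) _
      ⟨j.symm ≪≫ (hloc cc).some⟩
  -- Step 6: glue the local classifying maps (uniqueness from (K))
  have hcompat : ∀ i j : ULift.{u} (Fin g ⊕ Fin g → ZMod n),
      pullback.fst (𝒰.f i) (𝒰.f j) ≫ gloc i = pullback.snd (𝒰.f i) (𝒰.f j) ≫ gloc j := by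
    intro i j
    let fV : pullback (𝒰.f i) (𝒰.f j) ⟶ S := pullback.fst (𝒰.f i) (𝒰.f j) ≫ (U i).ι ≫ c ≫ f
    have hji : (pullback.snd (𝒰.f i) (𝒰.f j) ≫ (U j).ι) ≫ c ≫ f = fV := by
      change (pullback.snd (𝒰.f i) (𝒰.f j) ≫ 𝒰.f j) ≫ c ≫ f = pullback.fst (𝒰.f i) (𝒰.f j) ≫ 𝒰.f i ≫ c ≫ f
      rw [Category.assoc, ← pullback.condition_assoc]
    obtain ⟨s₁⟩ := (hsol i).map fun e₁ => B.restrictSolutionIso Bh PB (pullback.fst (𝒰.f i) (𝒰.f j)) rfl (hgloc i) e₁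
    obtain ⟨s₂⟩ := (hsol j).map fun e₂ => B.restrictSolutionIso Bh PB (pullback.snd (𝒰.f i) (𝒰.f j)) hji (hgloc j) e₂
    -- both restricted data are `(1_B × (V → T₁ → T))^* ℒ`
    have hLL : Nonempty ((Scheme.Modules.pullback (B.prodMap fV _ (pullback.snd (𝒰.f i) (𝒰.f j)) hji)).obj
        ((Scheme.Modules.pullback (B.prodMap ((U j).ι ≫ c ≫ f) (c ≫ f) (U j).ι rfl)).obj F₀) ≅
        (Scheme.Modules.pullback (B.prodMap fV _ (pullback.fst (𝒰.f i) (𝒰.f j)) rfl)).obj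
        ((Scheme.Modules.pullback (B.prodMap ((U i).ι ≫ c ≫ f) (c ≫ f) (U i).ι rfl)).obj F₀)) := by
      refine ⟨(Scheme.Modules.pullbackComp _ _).app _ ≪≫ (Scheme.Modules.pullbackCongr ?_).app _ ≪≫
        ((Scheme.Modules.pullbackComp _ _).app _).symm⟩
      rw [B.prodMap_comp, B.prodMap_comp]
      exact B.prodMap_congr _ _ (pullback.condition (f := 𝒰.f i) (g := 𝒰.f j)).symm _ _
    exact A.eq_of_pullback_baseChangeToProd_poincareQuotRigid_iso u K hK hcov hG hsm hgc D hfree K' hcov' hG' hsm' hgc'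
      hfree' Φ hStab fV (pullback.fst (𝒰.f i) (𝒰.f j) ≫ gloc i) (pullback.snd (𝒰.f i) (𝒰.f j) ≫ gloc j)
      (by rw [Category.assoc, hgloc i]) (by rw [Category.assoc, hgloc j, ← Category.assoc, hji])
      ⟨s₁ ≪≫ (hLL.some).symm ≪≫ s₂.symm⟩
  let g₁ : T₁ ⟶ Bh.X.left := Scheme.Cover.glueMorphisms 𝒰 gloc hcompat
  have hgι : ∀ i, 𝒰.f i ≫ g₁ = gloc i := fun i => Scheme.Cover.ι_glueMorphisms 𝒰 gloc hcompat i
  have hg₁ : g₁ ≫ Bh.X.hom = c ≫ f :=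
    Scheme.Cover.hom_ext 𝒰 _ _ fun i => by rw [← Category.assoc, hgι i, hgloc i]; rfl
  -- Step 7: the isomorphism on `T₁`, glued from the pieces (★ `nonempty_iso_of_openCover_of_isLocallyNoetherian`)
  let M₁ : B.RigidifiedLineBundle (c ≫ f) :=
    { L := (Scheme.Modules.pullback (B.baseChangeToProd Bh (c ≫ f) g₁ hg₁)).obj PB
      hasRank_one := hasRank_pullback _
        (A.hasRank_poincareQuotRigid u K hK hcov hG hsm hgc D hfree K' hcov' hG' hsm' hgc' hfree' Φ)
      rigid := B.nonempty_pullback_unitSection_baseChangeToProd_iso Bh PB (c ≫ f) g₁ hg₁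
        (A.rigid_poincareQuotRigid u K hK hcov hG hsm hgc D hfree K' hcov' hG' hsm' hgc' hfree' Φ) }
  let M₂ : B.RigidifiedLineBundle (c ≫ f) := ℒ.comapAlong c rfl
  have hMloc : ∀ i, Nonempty ((Scheme.Modules.pullback (B.prodMap (𝒰.f i ≫ c ≫ f) (c ≫ f) (𝒰.f i) rfl)).obj M₁.L ≅
      (Scheme.Modules.pullback (B.prodMap (𝒰.f i ≫ c ≫ f) (c ≫ f) (𝒰.f i) rfl)).obj M₂.L) := by
    intro i
    obtain ⟨j⟩ := B.nonempty_pullback_prodMap_pullback_baseChangeToProd_iso Bh PB (𝒰.f i ≫ c ≫ f) (c ≫ f) (𝒰.f i) rfl g₁ hg₁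
    obtain ⟨s⟩ := hsol i
    refine ⟨j ≪≫ (Scheme.Modules.pullbackCongr (B.baseChangeToProd_congr Bh _ (hgι i) _ (hgloc i))).app PB ≪≫ s⟩
  obtain ⟨I⟩ := RigidifiedLineBundle.nonempty_iso_of_openCover_of_isLocallyNoetherian M₁ M₂ 𝒰 hMloc
  exact ⟨T₁, c, inferInstance, inferInstance, inferInstance, g₁, hg₁, ⟨I⟩⟩

include hfree' in
/-- **The same, in the fpqc-cover shape consumed by the (α2) wiring** (`AbelianSchemeQuotientDualPairUniversal`, hypothesis `hloc`:
`Surjective`, `Flat`, `QuasiCompact`, `IsAffineHom` — a finite morphism is affine, hence quasi-compact — then ★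
`ClassifyingMapFpqcDescent.exists_desc_of_solution_of_unique` and (u6b)). [cite: MumfordAV1970, §15 Thm. 1 (p. 143)]
[cite: GortzWedhorn2020, Thm. 14.72] -/
theorem exists_fpqcCover_pullback_poincareQuotRigid_iso [IsReduced S] [IsLocallyNoetherian S] [IsCommMonObj D.hat.X] {g : ℕ}
    (φ : LevelStructure g n D.hat) (hn : ∀ s : S, (n : S.residueField s) ≠ 0) (hcard : Nat.card K * Nat.card K' = n ^ (2 * g))
    (hD : Nonempty ((Scheme.Modules.pullback (DualPair.unitHatSlice D)).obj D.P ≅ SheafOfModules.unit _))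
    (hStab : ∀ {T : Scheme.{u}} (f : T ⟶ S) (a a' : T ⟶ D.hat.X.left) (ha : a ≫ D.hat.X.hom = f)
      (ha' : a' ≫ D.hat.X.hom = f),
      Nonempty ((Scheme.Modules.pullback ((A.quotientBy u K hcov hG hsm hgc).baseChangeToProd D.hat f a ha)).obj
          (A.poincarePullbackBundle u K hK hcov hG hsm hgc D hfree).L ≅
        (Scheme.Modules.pullback ((A.quotientBy u K hcov hG hsm hgc).baseChangeToProd D.hat f a' ha')).obj
          (A.poincarePullbackBundle u K hK hcov hG hsm hgc D hfree).L) →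
      a ≫ (D.hat.quotientMk u K' hcov').left = a' ≫ (D.hat.quotientMk u K' hcov').left)
    (hSteinA : ∀ {T : Scheme.{u}} (f : T ⟶ S) (W : T.Opens), Function.Bijective ((A.baseChange f).X.hom.app W))
    {T : Scheme.{u}} (f : T ⟶ S) (ℒ : (A.quotientBy u K hcov hG hsm hgc).RigidifiedLineBundle f) (hℒ : ℒ.FibrewisePicZero) :
    ∃ (T₁ : Scheme.{u}) (c : T₁ ⟶ T) (_ : Surjective c) (_ : Flat c) (_ : QuasiCompact c) (_ : IsAffineHom c)
      (g₁ : T₁ ⟶ (D.hat.quotientBy u K' hcov' hG' hsm' hgc').X.left)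
      (hg₁ : g₁ ≫ (D.hat.quotientBy u K' hcov' hG' hsm' hgc').X.hom = c ≫ f),
      Nonempty ((Scheme.Modules.pullback ((A.quotientBy u K hcov hG hsm hgc).baseChangeToProd
          (D.hat.quotientBy u K' hcov' hG' hsm' hgc') (c ≫ f) g₁ hg₁)).obj
            (A.poincareQuotRigid u K hK hcov hG hsm hgc D hfree K' hcov' hG' hsm' hgc' Φ) ≅
        (Scheme.Modules.pullback ((A.quotientBy u K hcov hG hsm hgc).prodMap (c ≫ f) f c rfl)).obj ℒ.L) := by
  obtain ⟨T₁, c, hs, hf, hfin, g₁, hg₁, h⟩ := A.exists_finiteCover_pullback_poincareQuotRigid_iso u K hK hcov hG hsm hgc D hfree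
    K' hcov' hG' hsm' hgc' hfree' Φ φ hn hcard hD hStab hSteinA f ℒ hℒ
  haveI := hfin
  exact ⟨T₁, c, hs, hf, inferInstance, inferInstance, g₁, hg₁, h⟩

include hfree' in
/-- **The head with STEIN discharged** (`S` locally Noetherian ⇒ every abelian scheme over `S` is universally Stein, ★
`AbelianSchemeSteinOfNoetherian.baseChange_app_bijective`): the fpqc-cover shape of ★ p753003's `hloc`, with the binders
`φ̂, hn, hcard, hD, hStab` only. [cite: MumfordAV1970, §15 Thm. 1 (p. 143)] [cite: GortzWedhorn2020, Thm. 14.72] -/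
theorem exists_fpqcCover_pullback_poincareQuotRigid_iso_of_isLocallyNoetherian [IsReduced S] [IsLocallyNoetherian S]
    [IsCommMonObj D.hat.X] {g : ℕ}
    (φ : LevelStructure g n D.hat) (hn : ∀ s : S, (n : S.residueField s) ≠ 0) (hcard : Nat.card K * Nat.card K' = n ^ (2 * g))
    (hD : Nonempty ((Scheme.Modules.pullback (DualPair.unitHatSlice D)).obj D.P ≅ SheafOfModules.unit _))
    (hStab : ∀ {T : Scheme.{u}} (f : T ⟶ S) (a a' : T ⟶ D.hat.X.left) (ha : a ≫ D.hat.X.hom = f)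
      (ha' : a' ≫ D.hat.X.hom = f),
      Nonempty ((Scheme.Modules.pullback ((A.quotientBy u K hcov hG hsm hgc).baseChangeToProd D.hat f a ha)).obj
          (A.poincarePullbackBundle u K hK hcov hG hsm hgc D hfree).L ≅
        (Scheme.Modules.pullback ((A.quotientBy u K hcov hG hsm hgc).baseChangeToProd D.hat f a' ha')).obj
          (A.poincarePullbackBundle u K hK hcov hG hsm hgc D hfree).L) →
      a ≫ (D.hat.quotientMk u K' hcov').left = a' ≫ (D.hat.quotientMk u K' hcov').left)
    {T : Scheme.{u}} (f : T ⟶ S) (ℒ : (A.quotientBy u K hcov hG hsm hgc).RigidifiedLineBundle f) (hℒ : ℒ.FibrewisePicZero) :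
    ∃ (T₁ : Scheme.{u}) (c : T₁ ⟶ T) (_ : Surjective c) (_ : Flat c) (_ : QuasiCompact c) (_ : IsAffineHom c)
      (g₁ : T₁ ⟶ (D.hat.quotientBy u K' hcov' hG' hsm' hgc').X.left)
      (hg₁ : g₁ ≫ (D.hat.quotientBy u K' hcov' hG' hsm' hgc').X.hom = c ≫ f),
      Nonempty ((Scheme.Modules.pullback ((A.quotientBy u K hcov hG hsm hgc).baseChangeToProd
          (D.hat.quotientBy u K' hcov' hG' hsm' hgc') (c ≫ f) g₁ hg₁)).obj
            (A.poincareQuotRigid u K hK hcov hG hsm hgc D hfree K' hcov' hG' hsm' hgc' Φ) ≅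
        (Scheme.Modules.pullback ((A.quotientBy u K hcov hG hsm hgc).prodMap (c ≫ f) f c rfl)).obj ℒ.L) :=
  A.exists_fpqcCover_pullback_poincareQuotRigid_iso u K hK hcov hG hsm hgc D hfree K' hcov' hG' hsm' hgc' hfree' Φ φ hn hcard hD
    hStab (fun f' W => A.baseChange_app_bijective f' W) f ℒ hℒ

end Head

end AbelianSchemeOver

end Literature.AlgebraicGeometry.AbelianSchemes

end
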